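import Literature.AlgebraicGeometry.Hu2025.Statements.S03Pluecker.R101aPlatform
import Literature.AlgebraicGeometry.Motives.FanoSchemeOfPlanes
import HarnessLib

/-!
# Hu 2025 §3.1 — the SIGNED DICTIONARY to the tree's Plücker coordinates (PARTITION-HU §1c anchor) and the identification of Hu's `F_{h,k}`
# (pluckerEq) with `Motives.FanoPlanes.plueckerRel 2 n' k (h, k)`: `treeDict_pl`, `treeDict_plueckerRel`, and `I_℘ = treeDict(⟨grassmannEquations⟩)`
# (`IPl_eq_map_treeDict`, §4) (row 101, typer res-type-009; OURS bookkeeping,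
# no printed counterpart beyond p0016 l.107–121)

**HONEST FRAMING (D-0012/D-0089).** Bookkeeping between two presentations of the same Plücker ring: the tree (`Motives/FanoSchemeOfPlanes.lean`)
indexes homogeneous coordinates by ORDERED multi-indices `I : Fin 3 → Fin (n'+1)` and imposes alternation/repetition as relations; Hu indexes by
increasing triples in `[n] = {1,…,n}`, `n = n' + 1`, with the sign convention (signConvention). The `k`-algebra map `treeDict : pl I ↦ pCoord k (I 0 + 1)
(I 1 + 1) (I 2 + 1)` (shift `Fin (n'+1) = {0,…,n'} → [n]`) sends the tree's `plueckerRel 2 n' k (h, k)` to row 101a's `plRel k (h 0 + 1) (h 1 + 1)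
(k 0 + 1) ⋯ (k 3 + 1)` — so nothing of the Grassmannian is re-declared by row 101 (PARTITION-HU §1c «never re-declare a second Grassmannian»). Nothing of the
preprint is asserted; AI proof, weaker than expert review.
-/

noncomputable section

namespace Literature.AlgebraicGeometry.Hu2025.Statements.S03Pluecker

open MvPolynomial
open Literature.AlgebraicGeometry.Motives

universe u

variable (n' : ℕ) (k : Type u) [CommRing k]

/-- **The signed dictionary** from the tree's Plücker ring (ordered multi-indices `I : Fin 3 → Fin (n'+1)`) to row 101a's `PlRing (n'+1) k`
(increasing triples in `[n'+1]`): `p_I ↦ p_{(I₀+1)(I₁+1)(I₂+1)}` read with (signConvention). OURS bookkeeping.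
[cite: Hu2025, §3a (pluckerEq) = (3.3) and I_℘, p.34 l.3–8, l.28–30 (unrefereed preprint arXiv:2507.21400v1 under adjudication, D-0012/D-0089
— kernel support on OUR typed carriers of row 101; nothing of the source asserted)] -/
def treeDict : MvPolynomial (Fin (FanoPlanes.plDim 2 n' + 1)) k →ₐ[k] PlRing (n' + 1) k :=
  aeval fun i => pCoord k (((FanoPlanes.plIdx 2 n').symm i 0 : ℕ) + 1) (((FanoPlanes.plIdx 2 n').symm i 1 : ℕ) + 1)
    (((FanoPlanes.plIdx 2 n').symm i 2 : ℕ) + 1)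

/-- The dictionary on a coordinate: `treeDict (pl I) = pCoord (I₀+1) (I₁+1) (I₂+1)`.
[cite: Hu2025, §3a (pluckerEq) = (3.3) and I_℘, p.34 l.3–8, l.28–30 (unrefereed preprint arXiv:2507.21400v1 under adjudication, D-0012/D-0089
— kernel support on OUR typed carriers of row 101; nothing of the source asserted)] -/
theorem treeDict_pl (I : Fin 3 → Fin (n' + 1)) :
    treeDict n' k (FanoPlanes.pl 2 n' k I) = pCoord k ((I 0 : ℕ) + 1) ((I 1 : ℕ) + 1) ((I 2 : ℕ) + 1) := by
  unfold treeDict FanoPlanes.pl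
  rw [aeval_X]
  simp only [Equiv.symm_apply_apply]

/-- **Hu's `F_{h,k}` is the tree's `plueckerRel` through the dictionary**: for `h : Fin 2 → Fin (n'+1)`, `k : Fin 4 → Fin (n'+1)`,
`treeDict (plueckerRel 2 n' k (h, k)) = plRel k (h₀+1) (h₁+1) (k₀+1) (k₁+1) (k₂+1) (k₃+1)` (both are
`p_{h₀h₁k₀}p_{k₁k₂k₃} − p_{h₀h₁k₁}p_{k₀k₂k₃} + p_{h₀h₁k₂}p_{k₀k₁k₃} − p_{h₀h₁k₃}p_{k₀k₁k₂}`).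
[cite: Hu2025, §3a (pluckerEq) = (3.3) and I_℘, p.34 l.3–8, l.28–30 (unrefereed preprint arXiv:2507.21400v1 under adjudication, D-0012/D-0089
— kernel support on OUR typed carriers of row 101; nothing of the source asserted)] -/
theorem treeDict_plueckerRel (h : Fin 2 → Fin (n' + 1)) (kk : Fin 4 → Fin (n' + 1)) :
    treeDict n' k (FanoPlanes.plueckerRel 2 n' k (h, kk)) =
      plRel k ((h 0 : ℕ) + 1) ((h 1 : ℕ) + 1) ((kk 0 : ℕ) + 1) ((kk 1 : ℕ) + 1) ((kk 2 : ℕ) + 1) ((kk 3 : ℕ) + 1) := by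
  unfold FanoPlanes.plueckerRel plRel
  rw [map_sum, Fin.sum_univ_four]
  simp only [map_mul, map_pow, map_neg, map_one, treeDict_pl]
  simp [Fin.snoc, Fin.succAbove, Fin.lt_def, Fin.castLT]
  ring

end Literature.AlgebraicGeometry.Hu2025.Statements.S03Pluecker

/-! ## §2 Alternation of the signed lookup on ARBITRARY index sequences; repetition; the dictionary kills the tree's alternation and
repetition relations -/

namespace Literature.AlgebraicGeometry.Hu2025.Statements.S03Pluecker

open MvPolynomial
open Literature.AlgebraicGeometry.Motives

universe u

variable {n : ℕ} (k : Type u) [CommRing k]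

/-- `sort3` is symmetric in its first two arguments.
[cite: Hu2025, §3a (pluckerEq) = (3.3) and I_℘, p.34 l.3–8, l.28–30 (unrefereed preprint arXiv:2507.21400v1 under adjudication, D-0012/D-0089
— kernel support on OUR typed carriers of row 101; nothing of the source asserted)] -/
theorem sort3_swap12 (a b c : ℕ) : sort3 b a c = sort3 a b c := by
  unfold sort3; simp only [Prod.mk.injEq]; omega

/-- `sort3` is symmetric in its last two arguments.
[cite: Hu2025, §3a (pluckerEq) = (3.3) and I_℘, p.34 l.3–8, l.28–30 (unrefereed preprint arXiv:2507.21400v1 under adjudication, D-0012/D-0089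
— kernel support on OUR typed carriers of row 101; nothing of the source asserted)] -/
theorem sort3_swap23 (a b c : ℕ) : sort3 a c b = sort3 a b c := by
  unfold sort3; simp only [Prod.mk.injEq]; omega

/-- A repeated index: `p_{aac} = 0` for the signed lookup (any order of the repeat handled by `pCoord_aab/aba/baa` of `KeyTrick.lean`;
restated here for arbitrary positions via `sort3`).
[cite: Hu2025, §3a (pluckerEq) = (3.3) and I_℘, p.34 l.3–8, l.28–30 (unrefereed preprint arXiv:2507.21400v1 under adjudication, D-0012/D-0089
— kernel support on OUR typed carriers of row 101; nothing of the source asserted)] -/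
theorem pTri_sort3_eq_zero_of_eq {a b c : ℕ} (h : a = b ∨ a = c ∨ b = c) : (pTri k (sort3 a b c) : PlRing n k) = 0 := by
  unfold pTri
  rw [dif_neg]
  unfold sort3 plIndexSet
  simp only [Finset.mem_filter, Finset.mem_product, Finset.mem_Icc, not_and, not_lt]
  intros
  omega

/-- **Alternation, first two slots**: `p_{bac} = −p_{abc}` for ALL `a, b, c`.
[cite: Hu2025, §3a (pluckerEq) = (3.3) and I_℘, p.34 l.3–8, l.28–30 (unrefereed preprint arXiv:2507.21400v1 under adjudication, D-0012/D-0089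
— kernel support on OUR typed carriers of row 101; nothing of the source asserted)] -/
theorem pCoord_swap12 (a b c : ℕ) : (pCoord k b a c : PlRing n k) = -pCoord k a b c := by
  by_cases hab : a = b
  · subst hab
    rw [pCoord, pTri_sort3_eq_zero_of_eq k (Or.inl rfl), mul_zero, neg_zero]
  · have hpar : inv3 b a c = inv3 a b c + 1 ∨ inv3 a b c = inv3 b a c + 1 := by
      unfold inv3; split_ifs <;> omega
    rw [pCoord, pCoord, sort3_swap12]
    rcases hpar with h | h <;> rw [h, pow_succ] <;> ring

/-- **Alternation, last two slots**: `p_{acb} = −p_{abc}` for ALL `a, b, c`.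
[cite: Hu2025, §3a (pluckerEq) = (3.3) and I_℘, p.34 l.3–8, l.28–30 (unrefereed preprint arXiv:2507.21400v1 under adjudication, D-0012/D-0089
— kernel support on OUR typed carriers of row 101; nothing of the source asserted)] -/
theorem pCoord_swap23 (a b c : ℕ) : (pCoord k a c b : PlRing n k) = -pCoord k a b c := by
  by_cases hbc : b = c
  · subst hbc
    rw [pCoord, pTri_sort3_eq_zero_of_eq k (Or.inr (Or.inr rfl)), mul_zero, neg_zero]
  · have hpar : inv3 a c b = inv3 a b c + 1 ∨ inv3 a b c = inv3 a c b + 1 := by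
      unfold inv3; split_ifs <;> omega
    rw [pCoord, pCoord, sort3_swap23]
    rcases hpar with h | h <;> rw [h, pow_succ] <;> ring

/-- **Alternation, outer slots**: `p_{cba} = −p_{abc}`.
[cite: Hu2025, §3a (pluckerEq) = (3.3) and I_℘, p.34 l.3–8, l.28–30 (unrefereed preprint arXiv:2507.21400v1 under adjudication, D-0012/D-0089
— kernel support on OUR typed carriers of row 101; nothing of the source asserted)] -/
theorem pCoord_swap13 (a b c : ℕ) : (pCoord k c b a : PlRing n k) = -pCoord k a b c := by
  rw [pCoord_swap12 k b c a, pCoord_swap23 k b a c, pCoord_swap12 k a b c, neg_neg]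

/-- **Repetition**: the signed lookup vanishes when two indices coincide.
[cite: Hu2025, §3a (pluckerEq) = (3.3) and I_℘, p.34 l.3–8, l.28–30 (unrefereed preprint arXiv:2507.21400v1 under adjudication, D-0012/D-0089
— kernel support on OUR typed carriers of row 101; nothing of the source asserted)] -/
theorem pCoord_eq_zero_of_eq {a b c : ℕ} (h : a = b ∨ a = c ∨ b = c) : (pCoord k a b c : PlRing n k) = 0 := by
  rw [pCoord, pTri_sort3_eq_zero_of_eq k h, mul_zero]

/-- A transposition of two of the three slots flips the sign of the signed lookup (all index values).
[cite: Hu2025, §3a (pluckerEq) = (3.3) and I_℘, p.34 l.3–8, l.28–30 (unrefereed preprint arXiv:2507.21400v1 under adjudication, D-0012/D-0089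
— kernel support on OUR typed carriers of row 101; nothing of the source asserted)] -/
theorem pCoord_comp_swap (I : Fin 3 → ℕ) {x y : Fin 3} (hxy : x ≠ y) :
    (pCoord k (I (Equiv.swap x y 0)) (I (Equiv.swap x y 1)) (I (Equiv.swap x y 2)) : PlRing n k) = -pCoord k (I 0) (I 1) (I 2) := by
  have e01 : Equiv.swap (0 : Fin 3) 1 0 = 1 ∧ Equiv.swap (0 : Fin 3) 1 1 = 0 ∧ Equiv.swap (0 : Fin 3) 1 2 = 2 := by decide
  have e02 : Equiv.swap (0 : Fin 3) 2 0 = 2 ∧ Equiv.swap (0 : Fin 3) 2 1 = 1 ∧ Equiv.swap (0 : Fin 3) 2 2 = 0 := by decide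
  have e12 : Equiv.swap (1 : Fin 3) 2 0 = 0 ∧ Equiv.swap (1 : Fin 3) 2 1 = 2 ∧ Equiv.swap (1 : Fin 3) 2 2 = 1 := by decide
  fin_cases x <;> fin_cases y
  · exact absurd rfl hxy
  · rw [show Equiv.swap ((⟨0, by decide⟩ : Fin 3)) ⟨1, by decide⟩ = Equiv.swap (0 : Fin 3) 1 from rfl, e01.1, e01.2.1, e01.2.2]
    exact pCoord_swap12 k (I 0) (I 1) (I 2)
  · rw [show Equiv.swap ((⟨0, by decide⟩ : Fin 3)) ⟨2, by decide⟩ = Equiv.swap (0 : Fin 3) 2 from rfl, e02.1, e02.2.1, e02.2.2]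
    exact pCoord_swap13 k (I 0) (I 1) (I 2)
  · rw [show Equiv.swap ((⟨1, by decide⟩ : Fin 3)) ⟨0, by decide⟩ = Equiv.swap (0 : Fin 3) 1 from Equiv.swap_comm _ _, e01.1, e01.2.1,
      e01.2.2]
    exact pCoord_swap12 k (I 0) (I 1) (I 2)
  · exact absurd rfl hxy
  · rw [show Equiv.swap ((⟨1, by decide⟩ : Fin 3)) ⟨2, by decide⟩ = Equiv.swap (1 : Fin 3) 2 from rfl, e12.1, e12.2.1, e12.2.2]
    exact pCoord_swap23 k (I 0) (I 1) (I 2)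
  · rw [show Equiv.swap ((⟨2, by decide⟩ : Fin 3)) ⟨0, by decide⟩ = Equiv.swap (0 : Fin 3) 2 from Equiv.swap_comm _ _, e02.1, e02.2.1,
      e02.2.2]
    exact pCoord_swap13 k (I 0) (I 1) (I 2)
  · rw [show Equiv.swap ((⟨2, by decide⟩ : Fin 3)) ⟨1, by decide⟩ = Equiv.swap (1 : Fin 3) 2 from Equiv.swap_comm _ _, e12.1, e12.2.1,
      e12.2.2]
    exact pCoord_swap23 k (I 0) (I 1) (I 2)
  · exact absurd rfl hxy

/-- **The signed lookup is alternating**: for every permutation `σ` of the three slots,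
`p_{(I∘σ)} = sgn(σ) · p_I` — the convention (signConvention) p0016 l.92–97 as a THEOREM about `pCoord`.
[cite: Hu2025, §3a (pluckerEq) = (3.3) and I_℘, p.34 l.3–8, l.28–30 (unrefereed preprint arXiv:2507.21400v1 under adjudication, D-0012/D-0089
— kernel support on OUR typed carriers of row 101; nothing of the source asserted)] -/
theorem pCoord_perm (I : Fin 3 → ℕ) (σ : Equiv.Perm (Fin 3)) :
    (pCoord k (I (σ 0)) (I (σ 1)) (I (σ 2)) : PlRing n k) = ((Equiv.Perm.sign σ : ℤˣ) : ℤ) • pCoord k (I 0) (I 1) (I 2) := by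
  induction σ using Equiv.Perm.swap_induction_on generalizing I with
  | one => simp
  | swap_mul f x y hxy ih =>
    change (pCoord k ((I ∘ Equiv.swap x y) (f 0)) ((I ∘ Equiv.swap x y) (f 1)) ((I ∘ Equiv.swap x y) (f 2)) : PlRing n k) = _
    rw [ih (I ∘ Equiv.swap x y)]
    change _ • (pCoord k (I (Equiv.swap x y 0)) (I (Equiv.swap x y 1)) (I (Equiv.swap x y 2)) : PlRing n k) = _
    rw [pCoord_comp_swap k I hxy, Equiv.Perm.sign_mul, Equiv.Perm.sign_swap hxy, smul_neg, Units.val_mul, Units.val_neg,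
      Units.val_one, neg_one_mul, neg_smul]

/-- **The dictionary kills the tree's alternation relations** `pl (I ∘ σ) − sgn(σ) pl I`.
[cite: Hu2025, §3a (pluckerEq) = (3.3) and I_℘, p.34 l.3–8, l.28–30 (unrefereed preprint arXiv:2507.21400v1 under adjudication, D-0012/D-0089
— kernel support on OUR typed carriers of row 101; nothing of the source asserted)] -/
theorem treeDict_alternationRel (n' : ℕ) (I : Fin 3 → Fin (n' + 1)) (σ : Equiv.Perm (Fin 3)) :
    treeDict n' k (FanoPlanes.alternationRel 2 n' k (I, σ)) = 0 := by
  have h := pCoord_perm (n := n' + 1) k (fun i => (I i : ℕ) + 1) σ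
  unfold FanoPlanes.alternationRel
  dsimp only
  rw [map_sub, map_mul, treeDict_pl, treeDict_pl, MvPolynomial.algHom_C, ← Algebra.smul_def, Int.cast_smul_eq_zsmul]
  change (pCoord k ((I (σ 0) : ℕ) + 1) ((I (σ 1) : ℕ) + 1) ((I (σ 2) : ℕ) + 1) : PlRing (n' + 1) k) - _ = 0
  rw [h, sub_self]

/-- **The dictionary kills the tree's repetition relations** (a repeated index gives `0`).
[cite: Hu2025, §3a (pluckerEq) = (3.3) and I_℘, p.34 l.3–8, l.28–30 (unrefereed preprint arXiv:2507.21400v1 under adjudication, D-0012/D-0089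
— kernel support on OUR typed carriers of row 101; nothing of the source asserted)] -/
theorem treeDict_repetitionRel (n' : ℕ) (I : Fin 3 → Fin (n' + 1)) :
    treeDict n' k (FanoPlanes.repetitionRel 2 n' k I) = 0 := by
  unfold FanoPlanes.repetitionRel
  split_ifs with hI
  · rw [map_zero]
  · rw [treeDict_pl]
    apply pCoord_eq_zero_of_eq (n := n' + 1) k
    by_contra hne
    apply hI
    intro i j hij
    have hv : (I i : ℕ) + 1 = (I j : ℕ) + 1 := by rw [hij]
    fin_cases i <;> fin_cases j
    · rfl
    · exact absurd (Or.inl hv) hne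
    · exact absurd (Or.inr (Or.inl hv)) hne
    · exact absurd (Or.inl hv.symm) hne
    · rfl
    · exact absurd (Or.inr (Or.inr hv)) hne
    · exact absurd (Or.inr (Or.inl hv.symm)) hne
    · exact absurd (Or.inr (Or.inr hv.symm)) hne
    · rfl

/-! ## §3 Hu's `I_℘` comes from the tree's Grassmann equations through the dictionary -/

/-- **`I_℘ ⊆ treeDict(⟨grassmannEquations⟩)`**: every Hu Plücker relation `F_{h,k}` (`h`, `k` increasing in `[n'+1]`) is the dictionary image of the
tree's `plueckerRel 2 n' k (h−1, k−1)`. (The reverse inclusion is §4 below: `map_treeDict_le_IPl`, `IPl_eq_map_treeDict`.)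
[cite: Hu2025, §3a (pluckerEq) = (3.3) and I_℘, p.34 l.3–8, l.28–30 (unrefereed preprint arXiv:2507.21400v1 under adjudication, D-0012/D-0089
— kernel support on OUR typed carriers of row 101; nothing of the source asserted)] -/
theorem IPl_le_map_treeDict (n' : ℕ) :
    IPl (n' + 1) k ≤ (Ideal.span (FanoPlanes.grassmannEquations 2 n' k)).map (treeDict n' k) := by
  unfold IPl
  rw [Ideal.span_le]
  rintro F ⟨h₁, h₂, k₁, k₂, k₃, k₄, hh₁, h12, hh₂, hk₁, k12, k23, k34, hk₄, rfl⟩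
  -- the tree indices (shift by −1)
  let h : Fin 2 → Fin (n' + 1) := ![⟨h₁ - 1, by omega⟩, ⟨h₂ - 1, by omega⟩]
  let kk : Fin 4 → Fin (n' + 1) := ![⟨k₁ - 1, by omega⟩, ⟨k₂ - 1, by omega⟩, ⟨k₃ - 1, by omega⟩, ⟨k₄ - 1, by omega⟩]
  have hmem : FanoPlanes.plueckerRel 2 n' k (h, kk) ∈ Ideal.span (FanoPlanes.grassmannEquations 2 n' k) :=
    Ideal.subset_span (Set.mem_union_right _ ⟨(h, kk), rfl⟩)
  have himg := Ideal.mem_map_of_mem (treeDict n' k) hmem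
  rw [treeDict_plueckerRel] at himg
  have e : (plRel k (((h 0 : Fin (n' + 1)) : ℕ) + 1) (((h 1 : Fin (n' + 1)) : ℕ) + 1) (((kk 0 : Fin (n' + 1)) : ℕ) + 1)
      (((kk 1 : Fin (n' + 1)) : ℕ) + 1) (((kk 2 : Fin (n' + 1)) : ℕ) + 1) (((kk 3 : Fin (n' + 1)) : ℕ) + 1) : PlRing (n' + 1) k) =
      plRel k h₁ h₂ k₁ k₂ k₃ k₄ := by
    simp only [h, kk, Matrix.cons_val_zero, Matrix.cons_val_one, Matrix.cons_val_two, Matrix.cons_val_three, Matrix.head_cons,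
      Matrix.tail_cons]
    congr 1 <;> omega
  rw [e] at himg
  exact himg

/-! ## §4 The reverse inclusion: the dictionary image of ALL the tree's Grassmann equations lies in `I_℘` (so `I_℘ = treeDict(⟨grassmannEquations⟩)`) -/

section Reverse

variable {k}
variable {n : ℕ}

/-- `F_{h,k}` changes sign under swapping the pair `h`.
[cite: Hu2025, §3a (pluckerEq) = (3.3) and I_℘, p.34 l.3–8, l.28–30 (unrefereed preprint arXiv:2507.21400v1 under adjudication, D-0012/D-0089
— kernel support on OUR typed carriers of row 101; nothing of the source asserted)] -/
theorem plRel_swap_h (a b c d e f : ℕ) : (plRel k b a c d e f : PlRing n k) = -plRel k a b c d e f := by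
  unfold plRel
  rw [pCoord_swap12 k a b c, pCoord_swap12 k a b d, pCoord_swap12 k a b e, pCoord_swap12 k a b f]
  ring

/-- `F_{h,k}` changes sign under swapping `k₁, k₂`.
[cite: Hu2025, §3a (pluckerEq) = (3.3) and I_℘, p.34 l.3–8, l.28–30 (unrefereed preprint arXiv:2507.21400v1 under adjudication, D-0012/D-0089
— kernel support on OUR typed carriers of row 101; nothing of the source asserted)] -/
theorem plRel_swap_k12 (a b c d e f : ℕ) : (plRel k a b d c e f : PlRing n k) = -plRel k a b c d e f := by
  unfold plRel
  rw [pCoord_swap12 k c d f, pCoord_swap12 k c d e]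
  ring

/-- `F_{h,k}` changes sign under swapping `k₂, k₃`.
[cite: Hu2025, §3a (pluckerEq) = (3.3) and I_℘, p.34 l.3–8, l.28–30 (unrefereed preprint arXiv:2507.21400v1 under adjudication, D-0012/D-0089
— kernel support on OUR typed carriers of row 101; nothing of the source asserted)] -/
theorem plRel_swap_k23 (a b c d e f : ℕ) : (plRel k a b c e d f : PlRing n k) = -plRel k a b c d e f := by
  unfold plRel
  rw [pCoord_swap12 k d e f, pCoord_swap23 k c d e]
  ring

/-- `F_{h,k}` changes sign under swapping `k₃, k₄`.
[cite: Hu2025, §3a (pluckerEq) = (3.3) and I_℘, p.34 l.3–8, l.28–30 (unrefereed preprint arXiv:2507.21400v1 under adjudication, D-0012/D-0089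
— kernel support on OUR typed carriers of row 101; nothing of the source asserted)] -/
theorem plRel_swap_k34 (a b c d e f : ℕ) : (plRel k a b c d f e : PlRing n k) = -plRel k a b c d e f := by
  unfold plRel
  rw [pCoord_swap23 k d e f, pCoord_swap23 k c e f]
  ring

/-- `F_{h,k} = 0` when `h₁ = h₂`.
[cite: Hu2025, §3a (pluckerEq) = (3.3) and I_℘, p.34 l.3–8, l.28–30 (unrefereed preprint arXiv:2507.21400v1 under adjudication, D-0012/D-0089
— kernel support on OUR typed carriers of row 101; nothing of the source asserted)] -/
theorem plRel_eq_zero_h (a c d e f : ℕ) : (plRel k a a c d e f : PlRing n k) = 0 := by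
  unfold plRel
  rw [pCoord_eq_zero_of_eq k (Or.inl rfl), pCoord_eq_zero_of_eq k (Or.inl rfl), pCoord_eq_zero_of_eq k (Or.inl rfl),
    pCoord_eq_zero_of_eq k (Or.inl rfl)]
  ring

/-- `F_{h,k} = 0` when `k₁ = k₂`.
[cite: Hu2025, §3a (pluckerEq) = (3.3) and I_℘, p.34 l.3–8, l.28–30 (unrefereed preprint arXiv:2507.21400v1 under adjudication, D-0012/D-0089
— kernel support on OUR typed carriers of row 101; nothing of the source asserted)] -/
theorem plRel_eq_zero_k12 (a b c e f : ℕ) : (plRel k a b c c e f : PlRing n k) = 0 := by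
  unfold plRel
  rw [pCoord_eq_zero_of_eq k (a := c) (b := c) (c := f) (Or.inl rfl), pCoord_eq_zero_of_eq k (a := c) (b := c) (c := e) (Or.inl rfl)]
  ring

/-- `F_{h,k} = 0` when `k₂ = k₃`.
[cite: Hu2025, §3a (pluckerEq) = (3.3) and I_℘, p.34 l.3–8, l.28–30 (unrefereed preprint arXiv:2507.21400v1 under adjudication, D-0012/D-0089
— kernel support on OUR typed carriers of row 101; nothing of the source asserted)] -/
theorem plRel_eq_zero_k23 (a b c d f : ℕ) : (plRel k a b c d d f : PlRing n k) = 0 := by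
  unfold plRel
  rw [pCoord_eq_zero_of_eq k (a := d) (b := d) (c := f) (Or.inl rfl), pCoord_eq_zero_of_eq k (a := c) (b := d) (c := d) (Or.inr (Or.inr rfl))]
  ring

/-- `F_{h,k} = 0` when `k₃ = k₄`.
[cite: Hu2025, §3a (pluckerEq) = (3.3) and I_℘, p.34 l.3–8, l.28–30 (unrefereed preprint arXiv:2507.21400v1 under adjudication, D-0012/D-0089
— kernel support on OUR typed carriers of row 101; nothing of the source asserted)] -/
theorem plRel_eq_zero_k34 (a b c d e : ℕ) : (plRel k a b c d e e : PlRing n k) = 0 := by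
  unfold plRel
  rw [pCoord_eq_zero_of_eq k (a := d) (b := e) (c := e) (Or.inr (Or.inr rfl)), pCoord_eq_zero_of_eq k (a := c) (b := e) (c := e) (Or.inr (Or.inr rfl))]
  ring

/-- Sorting four natural numbers by adjacent transpositions: a predicate closed under the three adjacent swaps and true on weakly
increasing quadruples is true everywhere (five-comparator network).
[cite: Hu2025, §3a (pluckerEq) = (3.3) and I_℘, p.34 l.3–8, l.28–30 (unrefereed preprint arXiv:2507.21400v1 under adjudication, D-0012/D-0089
— kernel support on OUR typed carriers of row 101; nothing of the source asserted)] -/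
theorem sort4_induction {P : ℕ → ℕ → ℕ → ℕ → Prop}
    (h12 : ∀ c d e f, P d c e f → P c d e f) (h23 : ∀ c d e f, P c e d f → P c d e f)
    (h34 : ∀ c d e f, P c d f e → P c d e f) (hs : ∀ c d e f, c ≤ d → d ≤ e → e ≤ f → P c d e f)
    (c d e f : ℕ) : P c d e f := by
  -- last comparator `(d,e)` under `c ≤ d, c ≤ e, e ≤ f, d ≤ f`
  have L5 : ∀ c d e f, c ≤ d → c ≤ e → e ≤ f → d ≤ f → P c d e f := by
    intro c d e f hcd hce hef hdf
    rcases le_total d e with hde | hed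
    · exact hs c d e f hcd hde hef
    · exact h23 _ _ _ _ (hs c e d f hce hed hdf)
  -- comparator `(d,f)` under `c ≤ d, c ≤ e, e ≤ f`: `(c,f,e,d) → (c,e,f,d) → (c,e,d,f) → (c,d,e,f)`
  have L4 : ∀ c d e f, c ≤ d → c ≤ e → e ≤ f → P c d e f := by
    intro c d e f hcd hce hef
    rcases le_total d f with hdf | hfd
    · exact L5 c d e f hcd hce hef hdf
    · exact h23 _ _ _ _ (h34 _ _ _ _ (h23 _ _ _ _ (L5 c f e d (le_trans hce hef) hce (le_trans hef hfd) hfd)))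
  -- comparator `(c,e)` under `c ≤ d, e ≤ f`: `(e,f,c,d) → (e,c,f,d) → (c,e,f,d) → (c,e,d,f) → (c,d,e,f)`
  have L3 : ∀ c d e f, c ≤ d → e ≤ f → P c d e f := by
    intro c d e f hcd hef
    rcases le_total c e with hce | hec
    · exact L4 c d e f hcd hce hef
    · exact h23 _ _ _ _ (h34 _ _ _ _ (h12 _ _ _ _ (h23 _ _ _ _ (L4 e f c d hef hec hcd))))
  -- comparator `(e,f)` under `c ≤ d`
  have L2 : ∀ c d e f, c ≤ d → P c d e f := by
    intro c d e f hcd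
    rcases le_total e f with hef | hfe
    · exact L3 c d e f hcd hef
    · exact h34 _ _ _ _ (L3 c d f e hcd hfe)
  -- comparator `(c,d)`
  rcases le_total c d with hcd | hdc
  · exact L2 c d e f hcd
  · exact h12 _ _ _ _ (L2 d c e f hdc)

/-- **Every `F_{h,k}` with indices in `[n]` — in ANY order, repetitions allowed — lies in `I_℘`** (which is generated by the
increasing ones): `±` a generator, or `0`.
[cite: Hu2025, §3a (pluckerEq) = (3.3) and I_℘, p.34 l.3–8, l.28–30 (unrefereed preprint arXiv:2507.21400v1 under adjudication, D-0012/D-0089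
— kernel support on OUR typed carriers of row 101; nothing of the source asserted)] -/
theorem plRel_mem_IPl {a b c d e f : ℕ} (ha : 1 ≤ a ∧ a ≤ n) (hb : 1 ≤ b ∧ b ≤ n) (hc : 1 ≤ c ∧ c ≤ n) (hd : 1 ≤ d ∧ d ≤ n)
    (he : 1 ≤ e ∧ e ≤ n) (hf : 1 ≤ f ∧ f ≤ n) : (plRel k a b c d e f : PlRing n k) ∈ IPl n k := by
  -- normalise the pair `h`
  suffices H : ∀ a b : ℕ, 1 ≤ a → a < b → b ≤ n → (plRel k a b c d e f : PlRing n k) ∈ IPl n k by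
    rcases lt_trichotomy a b with hab | rfl | hab
    · exact H a b ha.1 hab hb.2
    · rw [plRel_eq_zero_h]; exact Ideal.zero_mem _
    · rw [← Ideal.neg_mem_iff, ← plRel_swap_h]; exact H b a hb.1 hab ha.2
  intro a b ha1 hab hbn
  -- sort the quadruple `k`
  revert hc hd he hf
  refine sort4_induction (P := fun c d e f => 1 ≤ c ∧ c ≤ n → 1 ≤ d ∧ d ≤ n → 1 ≤ e ∧ e ≤ n → 1 ≤ f ∧ f ≤ n →
    (plRel k a b c d e f : PlRing n k) ∈ IPl n k) ?_ ?_ ?_ ?_ c d e f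
  · intro c d e f h hc hd he hf
    rw [← Ideal.neg_mem_iff, ← plRel_swap_k12]; exact h hd hc he hf
  · intro c d e f h hc hd he hf
    rw [← Ideal.neg_mem_iff, ← plRel_swap_k23]; exact h hc he hd hf
  · intro c d e f h hc hd he hf
    rw [← Ideal.neg_mem_iff, ← plRel_swap_k34]; exact h hc hd hf he
  · intro c d e f hcd hde hef hc hd he hf
    rcases hcd.eq_or_lt with rfl | hcd'
    · rw [plRel_eq_zero_k12]; exact Ideal.zero_mem _
    rcases hde.eq_or_lt with rfl | hde'
    · rw [plRel_eq_zero_k23]; exact Ideal.zero_mem _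
    rcases hef.eq_or_lt with rfl | hef'
    · rw [plRel_eq_zero_k34]; exact Ideal.zero_mem _
    exact Ideal.subset_span ⟨a, b, c, d, e, f, ha1, hab, hbn, hc.1, hcd', hde', hef', hf.2, rfl⟩

variable (k)

/-- **`treeDict(⟨grassmannEquations⟩) ⊆ I_℘`**: the dictionary kills alternation and repetition relations and sends every tree Plücker
relation (arbitrary ordered multi-indices) to an `F_{h,k}` with indices in `[n'+1]`, which lies in `I_℘` by `plRel_mem_IPl`.
[cite: Hu2025, §3a (pluckerEq) = (3.3) and I_℘, p.34 l.3–8, l.28–30 (unrefereed preprint arXiv:2507.21400v1 under adjudication, D-0012/D-0089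
— kernel support on OUR typed carriers of row 101; nothing of the source asserted)] -/
theorem map_treeDict_le_IPl (n' : ℕ) :
    (Ideal.span (FanoPlanes.grassmannEquations 2 n' k)).map (treeDict n' k) ≤ IPl (n' + 1) k := by
  rw [Ideal.map_le_iff_le_comap, Ideal.span_le]
  rintro g hg
  rw [SetLike.mem_coe, Ideal.mem_comap]
  rcases hg with (⟨⟨I, σ⟩, rfl⟩ | ⟨I, rfl⟩) | ⟨⟨h, kk⟩, rfl⟩
  · rw [treeDict_alternationRel]; exact Ideal.zero_mem _
  · rw [treeDict_repetitionRel]; exact Ideal.zero_mem _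
  · rw [treeDict_plueckerRel]
    exact plRel_mem_IPl ⟨by omega, by omega⟩ ⟨by omega, by omega⟩ ⟨by omega, by omega⟩ ⟨by omega, by omega⟩
      ⟨by omega, by omega⟩ ⟨by omega, by omega⟩

/-- **`I_℘ = treeDict(⟨grassmannEquations⟩)`**: Hu's Plücker ideal (row 101a `IPl`, chunk p0017 l.1–4) IS the dictionary image of the
tree's Grassmann ideal of `Motives/FanoSchemeOfPlanes.lean` — the formal content of PARTITION-HU §1c «reuse the tree Grassmannian, never
re-declare».
[cite: Hu2025, §3a (pluckerEq) = (3.3) and I_℘, p.34 l.3–8, l.28–30 (unrefereed preprint arXiv:2507.21400v1 under adjudication, D-0012/D-0089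
— kernel support on OUR typed carriers of row 101; nothing of the source asserted)] -/
theorem IPl_eq_map_treeDict (n' : ℕ) :
    IPl (n' + 1) k = (Ideal.span (FanoPlanes.grassmannEquations 2 n' k)).map (treeDict n' k) :=
  le_antisymm (IPl_le_map_treeDict k n') (map_treeDict_le_IPl k n')

end Reverse

end Literature.AlgebraicGeometry.Hu2025.Statements.S03Pluecker

end
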